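import Summits.BirchSwinnertonDyer.Rank1Residual.X11b.BDPFrameUniquenessInt
import Literature.NumberTheory.EllipticCurves.DeShalit1987.KatzPAdicLFunction
import HarnessLib

/-!
# Rigidity of one-variable de Shalit frames at FIXED periods: two witnesses of
# `DeShalit1987.IsKatzBranch` with the same data coincide on any admissible supply accumulating at `T = 0`
# (brick (f) of the [BRω] road R-ψ; helper file 32 for crux 2 `GoodLatticeBDPValue`,
# stmt-BirchSwinnertonDyer-19032, cell `bsd-eis` seat `bsd-eis-k5-c2`)

`DeShalit1987.IsKatzBranch ι v v̄ S κ γ λ Ω δ Ω_p G` prescribes the value of `G ∈ 𝒪_{ℂ_p}⟦T⟧` at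
`T = r(γ) − 1` for every ADMISSIBLE interpolation datum `(ρ, r, m, j, hL)` (a Hecke character `ρ` with
`p`-adic avatar `r` through `κ`, `λρ` of type `(−m, j)`, `0 ≤ j < m`, unramified outside `S ∪ {v̄}`, an
entire continuation `hL` of `L(λρ, s)`), and that value — `ι⁻¹(interpolationValue …)·Ω_p^{m+j}` —
depends on the data `(ι, v, v̄, S, λ, Ω, δ, Ω_p)` and the datum ONLY, not on `G`. Hence two witnesses
`G, G'` of the SAME frame take the same values along every admissible sequence; if the points
`r_k(γ) − 1` tend to `0` and are non-zero infinitely often, `G = G'` by the identity principle over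
`𝒪_{ℂ_p}⟦T⟧` (`R1.intSeries_eq_of_hasValueAt`, a Strassmann-type rigidity from values accumulating
at the centre; Cassels, *Local Fields*, Ch. 4). This is the de Shalit-frame twin of
`R1.isBDPLFunctionInt_unique_of_tendsto` (BDP frame).

* `isKatzBranch_ext_of_supply` — the statement above, the supply given as sequences
  `(ρ_k, r_k, m_k, j_k, hL_k)`.
* `isKatzBranch_forall_of_exists_of_supply` — "some witness has property `P`" ⟹ "every witness has
  `P`" under the supply (the form the ∀-witness / ∃-witness conversions of the cell use).

WHY (HOME/k5-c2-MEMO-6.md §4 (J3); HOME/k5-ty-g8/BR-OMEGA-ROAD.md §2 (f)): on road R-ψ for [BRω] the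
translated slice of the `ω̃_K⁻¹`-branch two-variable witness and the slice of the reflected
`𝟙̃_K⁻¹`-branch witness are two `IsKatzBranch … (𝟙̃_K·‖·‖) …` frames AT THE SAME PERIOD TRIPLE (Rubin's
Thm. 4.1 (i) gives one triple for all branches, `muLambda_of_rubin_two_branches`, p487464); this file
is the step "⇒ equal". NB: the rigidity must be run on a POINTED line — the anticyclotomic line of a
FINITE-ORDER branch has no admissible datum (characters through an anticyclotomic `κ` have type
`(k, −k)`, never `j < m`), whereas a branch `θ_K·‖·‖` (weight `−2`) has the points
`θ_K‖·‖φ⁻¹`, `φ` anticyclotomic of type `(n, −n)`, `n ≥ 1` (type `(−(n+1), n−1)`): the supply is a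
hypothesis here and is produced elsewhere (from `X11b.characterSupplyAt`). Pure `p`-adic analysis +
bookkeeping; no fact, no definition; nothing about BSD.
References: de Shalit 1987 II.4.16 (49)–(50), II.4.17 (52); Cassels 1986 Ch. 4 (Strassmann);
Katz 1978 / Kriz 2016 Thm. 27 ("unique"); HOME/k5-c2-MEMO-6.md §4; HOME/k5-ty-g8/BR-OMEGA-ROAD.md §2.
-/

-- the summit namespace `Summit.BirchSwinnertonDyer.BirchSwinnertonDyer` repeats the problem name by design (D-0017)
set_option linter.dupNamespace false
set_option autoImplicit false

noncomputable section

open scoped Classical Topology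

open Filter NumberField IsDedekindDomain Field PowerSeries Literature.NumberTheory.EllipticCurves
  Literature.NumberTheory.GaloisRepresentations Summit.BirchSwinnertonDyer.Rank1Residual.X11b

namespace Summit.BirchSwinnertonDyer.BirchSwinnertonDyer.Theorems.IwasawaTwoVariable

section Rigidity

variable {p : ℕ} [Fact p.Prime] {K : Type} [Field K] [NumberField K]
  {ι : PadicAlgCl p ≃+* ℂ} {v vbar : HeightOneSpectrum (𝓞 K)} {S : Finset (HeightOneSpectrum (𝓞 K))}
  {κ : ZpExtension K p} {γ : absoluteGaloisGroup K} {lam : HeckeCharacter K} {Ω δ : ℂ} {Ωp : ℂ_[p]}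

/-- **Rigidity of the one-variable de Shalit frame at fixed periods.** Two witnesses `G, G'` of
`DeShalit1987.IsKatzBranch ι v v̄ S κ γ λ Ω δ Ω_p` are EQUAL, given a supply of admissible interpolation
data `(ρ_k, r_k, m_k, j_k, hL_k)` (avatar `r_k` of `ρ_k` through `κ`, `λρ_k` of type `(−m_k, j_k)`,
`j_k < m_k`, unramified outside `S ∪ {v̄}`, `L(λρ_k, s)` entire) whose evaluation points satisfy
`r_k(γ) → 1` with `r_k(γ) ≠ 1` infinitely often: both series take the prescribed value
`ι⁻¹(interpolationValue p v v̄ S (λρ_k) m_k j_k Ω δ L(λρ_k,0))·Ω_p^{m_k+j_k}` at `r_k(γ) − 1 → 0`, so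
they coincide by `R1.intSeries_eq_of_hasValueAt`. [cite: deShalit1987, II.4.16 (49)–(50) (store chunk 76–77), II.4.17 (52) (store chunk 77)]
[cite: Cassels1986, Ch. 4 Thm. 4.1 (Strassmann)] -/
theorem isKatzBranch_ext_of_supply {G G' : PowerSeries 𝓞_ℂ_[p]}
    (hG : DeShalit1987.IsKatzBranch ι v vbar S κ γ lam Ω δ Ωp G)
    (hG' : DeShalit1987.IsKatzBranch ι v vbar S κ γ lam Ω δ Ωp G')
    {ρ : ℕ → HeckeCharacter K} {r : ℕ → FramedGaloisRep K (PadicAlgCl p) 1} {m j : ℕ → ℕ}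
    (hr : ∀ k, IsPAdicAvatarOf ι (ρ k) (r k)) (hκ : ∀ k, FactorsThroughZp κ (r k))
    (hjm : ∀ k, j k < m k)
    (hinf : ∀ k, (lam * ρ k).HasInfinityType (fun _ ↦ -(m k : ℤ)) (fun _ ↦ (j k : ℤ)))
    (hunr : ∀ k (w : HeightOneSpectrum (𝓞 K)), w ∉ S → w ≠ vbar → (lam * ρ k).IsUnramifiedAt w)
    (hL : ∀ k, LFunction.HasEntireContinuation (heckeLFunction (lam * ρ k)))
    (hlim : Tendsto (fun k ↦ avatarValueAt (r k) γ) atTop (𝓝 1))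
    (hne : ∃ᶠ k in atTop, avatarValueAt (r k) γ ≠ 1) : G = G' := by
  refine R1.intSeries_eq_of_hasValueAt (x := fun k ↦ avatarValueAt (r k) γ - 1)
    (v := fun k ↦ ((ι.symm (DeShalit1987.interpolationValue p v vbar S (lam * ρ k) (m k) (j k) Ω δ
        ((hL k).continuation 0)) : PadicAlgCl p) : ℂ_[p]) * Ωp ^ (m k + j k)) ?_ ?_
    (fun k ↦ hG (ρ k) (r k) (m k) (j k) (hr k) (hκ k) (hjm k) (hinf k) (hunr k) (hL k))
    (fun k ↦ hG' (ρ k) (r k) (m k) (j k) (hr k) (hκ k) (hjm k) (hinf k) (hunr k) (hL k))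
  · rw [← sub_self (1 : ℂ_[p])]
    exact hlim.sub_const 1
  · exact hne.mono fun k hk ↦ sub_ne_zero.mpr hk

/-- **"Some witness" = "every witness" under the supply**: if a witness `G` of the frame with a
property `P` exists and an admissible supply accumulating at `T = 0` is given, then every witness
has `P` (all witnesses are equal to `G`). [cite: deShalit1987, II.4.16 (49)–(50) (store chunk 76–77)]
[cite: Cassels1986, Ch. 4 Thm. 4.1 (Strassmann)] -/
theorem isKatzBranch_forall_of_exists_of_supply {P : PowerSeries 𝓞_ℂ_[p] → Prop}
    (hex : ∃ G, DeShalit1987.IsKatzBranch ι v vbar S κ γ lam Ω δ Ωp G ∧ P G)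
    {ρ : ℕ → HeckeCharacter K} {r : ℕ → FramedGaloisRep K (PadicAlgCl p) 1} {m j : ℕ → ℕ}
    (hr : ∀ k, IsPAdicAvatarOf ι (ρ k) (r k)) (hκ : ∀ k, FactorsThroughZp κ (r k))
    (hjm : ∀ k, j k < m k)
    (hinf : ∀ k, (lam * ρ k).HasInfinityType (fun _ ↦ -(m k : ℤ)) (fun _ ↦ (j k : ℤ)))
    (hunr : ∀ k (w : HeightOneSpectrum (𝓞 K)), w ∉ S → w ≠ vbar → (lam * ρ k).IsUnramifiedAt w)
    (hL : ∀ k, LFunction.HasEntireContinuation (heckeLFunction (lam * ρ k)))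
    (hlim : Tendsto (fun k ↦ avatarValueAt (r k) γ) atTop (𝓝 1))
    (hne : ∃ᶠ k in atTop, avatarValueAt (r k) γ ≠ 1)
    {G' : PowerSeries 𝓞_ℂ_[p]} (hG' : DeShalit1987.IsKatzBranch ι v vbar S κ γ lam Ω δ Ωp G') :
    P G' := by
  obtain ⟨G, hG, hP⟩ := hex
  rwa [← isKatzBranch_ext_of_supply hG hG' hr hκ hjm hinf hunr hL hlim hne]

omit [NumberField K] in
/-- **Inverse generator.** The frames of the two-variable road are read at the INVERSE generator
`γ⁻¹` (`IsKatzMeasure₂ … γ⁻¹ γ'⁻¹ …`, `muLambda_of_rubin_at_periods`): a supply accumulating at `γ`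
accumulates at `γ⁻¹` (`r(γ⁻¹) = r(γ)⁻¹ → 1`, and `≠ 1` exactly when `r(γ) ≠ 1`). [folklore] -/
theorem tendsto_avatarValueAt_inv_of_tendsto {r : ℕ → FramedGaloisRep K (PadicAlgCl p) 1}
    (hlim : Tendsto (fun k ↦ avatarValueAt (r k) γ) atTop (𝓝 1))
    (hne : ∃ᶠ k in atTop, avatarValueAt (r k) γ ≠ 1) :
    Tendsto (fun k ↦ avatarValueAt (r k) γ⁻¹) atTop (𝓝 1) ∧
      ∃ᶠ k in atTop, avatarValueAt (r k) γ⁻¹ ≠ 1 := by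
  have hinv : ∀ k, avatarValueAt (r k) γ⁻¹ = (avatarValueAt (r k) γ)⁻¹ := fun k ↦ by
    have h1 : avatarValueAt (r k) γ⁻¹ * avatarValueAt (r k) γ = 1 := by
      rw [← avatarValueAt_mul, inv_mul_cancel, avatarValueAt_one]
    exact eq_inv_of_mul_eq_one_left h1
  simp_rw [hinv]
  refine ⟨?_, hne.mono fun k hk h ↦ hk (inv_eq_one.mp h)⟩
  have h := (continuousAt_inv₀ (one_ne_zero (α := ℂ_[p]))).tendsto.comp hlim
  rw [inv_one] at h
  exact h

end Rigidity

end Summit.BirchSwinnertonDyer.BirchSwinnertonDyer.Theorems.IwasawaTwoVariable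

end
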